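import Summits.QuantumFields.YangMills.Theorems.UnitScaleTiltHalvingP1FlatCoreCubeInclusion
import Literature.MathematicalPhysics.QuantumFieldTheory.Balaban1983to89.B7Eq214FlatQprime
import Literature.MathematicalPhysics.QuantumFieldTheory.Balaban1983to89.B8Eq178Averages
import Literature.MathematicalPhysics.QuantumFieldTheory.Balaban1983to89.B8Eq1117Concrete
import HarnessLib

/-!
# Line H (`BirthV10.stub_halvingStep`, stmt-QuantumFields-19200), J4c **(T4b) FILE 1: THE TORUS DICTIONARY ROWS** for the top-level instance of
# ✓`HalvingP1FlatCoreTopStep.hFP_kLevel_family_RD` — (S2) «N05's linear restriction functional `Q′_k` at the flat background IS the torus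
# iterated site average read through the window representative», and the packaging of the (o)-target as an element of Sect. E's `X`-space

Cell `ym3-torus` (HUMAN RULING D-0037: YM₃ on T³ is ladder rung R3, NOT the Clay problem), width seat `ym-ust-19936-w8` gen 2 (LEAD-H ★w5-19200 g4
12:09:54Z «(T4b) → ★w8-19936 g2»; LOCATE memo `T4B-LOCATE-w8g2.md` = 19200 evidence).  `--supports stmt-QuantumFields-19200 --as helper`; THEOREMS ONLY
(0 `def`, 0 `sorry`); count-neutral; nothing here claims `core′`, the stub, the crux, d = 4 or the mass gap.

WHY.  The J4c socket ✓p632037 is stated in pub-ymgap N05's `ℤᵈ` letters: the linear part of the restriction functional is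
`Qlin j := QprimeIter (zdBlocking d L) (bgT L U₀) j` ([Balaban1985RegularSpaces] p. 80 «a linear part of `(1/i) log(R̄₀uʲ)(y)` is equal to
`(Q′_j(U₀)λ)(y)`»; [Balaban1985BackgroundPropagators] (3.19)), for which N05's letter `H′` is the right inverse (`hQH`) and whose kernel JOIN-B's `q`
encodes (`hQlin0`); the target `th` is an element of the `X`-space `B8Eq1117Concrete.XSpace d k 𝔸` (bounded functions on `Fin (k+1) × ℤᵈ`).
The TOP member of the family lives on the TORUS: `Cfam k μ y := log κ_k[μ ∘ rep](y♭) − (Q′_k (μ ∘ rep))(y♭)` with the torus iterated site average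
`LatticeFieldCalculus.siteAvgIter` (F2b ✓p632468 ∕ F3 ∕ F4 rows), `rep` the window representative of J1b∕J6 and `y♭ = π_k y` the level-`k` cover
(`Node00.coverAt`).  This file supplies the letter-independent dictionary rows the instance needs:
* §1 ★★ `siteAvgIter_comp_rep_coverAt_eq_qprimeIter` — AT THE FLAT BACKGROUND, for a representative map `rep` that inverts the cover on the `ℤᵈ`
  block `blockSites (Lʲ) y` (hypothesis `hrep`, the Q4 geometry row of the LOCATE memo; J1b ✓`existsUnique_rep`-class), the torus `j`-fold site
  average of `μ ∘ rep` at `π_j y` IS N05's `QprimeIter (zdBlocking d L) (bgT L 1) j μ y` — both are the uniform mean over the `L^{jd}` fine sites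
  (✓`Node00.siteAvgIter_coverAt` + ✓`B7Eq214FlatQprime.QprimeIter_one_eq_sum_blockSites` + ✓`B8Eq119TwistedAxial.bgT_one`); so the socket's
  `h213` at `j = k` is `sub_add_cancel` and `hQH`∕`hQlin0` stay N05's VERBATIM.
* §2 `blockSite_coverAt` (`blockSite (π_{j+1} z) r = π_j (L·z + r)`, the companion of ✓`Node00.emb_coverAt`), `blockMap_add_natCast_smul`,
  `sum_blockSites_add` (translating a label translates its block sum) — cover bookkeeping.
* §3 `norm_sub_le_l1_mul_of_box` — `ℓ¹` telescoping: a step bound inside a box `[lo, hi] ⊂ ℤᵈ` controls differences by the `ℓ¹` distance.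
* §4 ★★ `norm_siteAvgIter_coverAt_sub_le` — THE OSCILLATION TRANSFER: a fine-lattice step bound `g` for `l₀ ∘ π` inside a box gives
  `‖(Q′_j l₀)(π_j x′) − (Q′_j l₀)(π_j x)‖ ≤ |x′ − x|₁·Lʲ·g` for labels whose blocks lie in the box — the `hosc` supplier of ★w3-19936 g6's tower
  induction (✓p632468 F2b ∕ ✓p633797 F3 and their `_local` twins: stair end = ✓`walkEnd_emb_stairWord_eq_blockSite`, centre = ✓`emb_coverAt`), with
  `g = α₄L^{−k}` from the (1.120) gradient row at the flat background: `≤ d(L−1)α₄·L^{j−k}`, geometric from the top, `k`-uniform.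
* §5 ★ `exists_topTarget` — packaging a top-site datum `t : ℤᵈ → 𝔸` bounded by `τ` on `Λ` as `th : XSpace d k 𝔸` with `th (k, y) = t y` on `Λ`,
  `th = 0` below the top and off `Λ`, `‖th‖ ≤ τ`, and skewness inherited (`hth` of the socket) — Mathlib `BoundedContinuousFunction.ofNormedAddCommGroupDiscrete`.
HONEST SCOPE.  Bookkeeping over landed letters and elementary lattice arithmetic; no analytic estimate; the instance theorem is FILE 2 (after the
`_local` rows land).  Nothing of [Balaban1985RegularSpaces] Prop. 5 ∕ Sect. E is proved here.

References: T. Bałaban, CMP **99** (1985) 75–102 [Balaban1985RegularSpaces] (p.80, Sect. E (1.113)–(1.121) pp.95–96); CMP **98** (1985) 17–51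
[Balaban1985Averaging] ((212)–(213) p.50); CMP **95** (1984) 17–40 [Balaban1984PropagatorsI] ((1.20) p.20); CMP **116** (1988) [Balaban1987RG1] ((0.1) p.251).
-/

set_option autoImplicit false

noncomputable section

open scoped BigOperators

namespace Summit.QuantumFields.YangMills.Theorems.P1FlatCoreTopDictionary

open Literature.MathematicalPhysics.QuantumFieldTheory.Balaban1983to89
open T4Continuum
open B15Eq112TorusCover (cover)
open B14DomainGeom (Pt)
open Node00 (coverAt siteAvgIter_coverAt)
open LatticeFieldCalculus (siteAvgIter)
open Literature.MathematicalPhysics.QuantumLattice (blockMap blockSites mem_blockSites_iff card_blockSites)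
open B7Prop1Explicit (e e_apply l1)
open B7Prop1Local (InBox)
open B7Eq78Linearization (QprimeIter zdBlocking)
open B8Eq119TwistedAxial (bgT bgT_one)
open B7Eq214FlatQprime (QprimeIter_one_eq_sum_blockSites)
open B8Eq1117Concrete (XSpace)

/-! ## §1 (S2): N05's `Q′_j` at the flat background = the torus iterated site average through the representative -/

section LinearDictionary

variable {P : Params} {𝔸 : Type*} [NormedRing 𝔸] [NormedAlgebra ℂ 𝔸] [CompleteSpace 𝔸]

/-- ★★ **(S2) THE LINEAR DICTIONARY.**  Let `rep : T_η → ℤᵈ` invert the universal cover on the `ℤᵈ` block `blockSites (Lʲ) y` (`hrep`; for the window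
representative `s ↦ lift x₀ + rel x₀ s` of J1b∕J6 this holds on every block of N05's level-`0` cube under the no-wrap premise).  Then for every
`μ : ℤᵈ → 𝔸` the torus `j`-fold site average of `μ ∘ rep` at the level-`j` cover `π_j y` equals N05's linear restriction functional at the flat
background: `(Q′_j (μ ∘ rep))(π_j y) = QprimeIter (zdBlocking d L) (bgT L 1) j μ y` — both are `L^{−jd}·Σ_{x ∈ Bʲ(y)} μ(x)`.
[cite: Balaban1985RegularSpaces, p.80; Balaban1985Averaging, (212)-(213) p.50; Balaban1984PropagatorsI, (1.20) p.20] -/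
theorem siteAvgIter_comp_rep_coverAt_eq_qprimeIter {j : ℕ} (hj : j ≤ P.m + P.K) (μ : Pt P.d → 𝔸) (rep : Site P 0 → Pt P.d)
    (y : Pt P.d) (hrep : ∀ x ∈ blockSites (P.L ^ j) y, rep (cover P x) = x) :
    siteAvgIter j (μ ∘ rep) (coverAt P j y) = QprimeIter (zdBlocking P.d P.L) (bgT P.L (1 : Pt P.d → Fin P.d → 𝔸ˣ)) j μ y := by
  rw [bgT_one, QprimeIter_one_eq_sum_blockSites P.L_pos μ j y, siteAvgIter_coverAt hj (μ ∘ rep) y, Finset.smul_sum]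
  refine Finset.sum_congr rfl fun x hx => ?_
  rw [Function.comp_apply, hrep x hx, ← pow_mul, mul_comm]

/-- The same read as the socket's `h213` at the top level: with `Qfull k μ y := F μ y` (any top functional) and
`Cfam k μ y := F μ y − (Q′_k (μ ∘ rep))(π_k y)`, `Qfull k μ y = QprimeIter … k μ y + Cfam k μ y`. [cite: Balaban1985RegularSpaces, (1.113)-(1.114) p.95] -/
theorem h213_top {k : ℕ} (hk : k ≤ P.m + P.K) (F : (Pt P.d → 𝔸) → Pt P.d → 𝔸) (rep : Site P 0 → Pt P.d)
    (μ : Pt P.d → 𝔸) (y : Pt P.d) (hrep : ∀ x ∈ blockSites (P.L ^ k) y, rep (cover P x) = x) :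
    F μ y = QprimeIter (zdBlocking P.d P.L) (bgT P.L (1 : Pt P.d → Fin P.d → 𝔸ˣ)) k μ y +
      (F μ y - siteAvgIter k (μ ∘ rep) (coverAt P k y)) := by
  rw [siteAvgIter_comp_rep_coverAt_eq_qprimeIter hk μ rep y hrep, add_sub_cancel]

end LinearDictionary

/-! ## §2 Cover bookkeeping: block sites and block sums under the level covers -/

section Cover

variable {P : Params}

/-- **THE BLOCK SITES UNDER THE COVER**: `blockSite (π_{j+1} z) r = π_j (L·z + r)` (standing range) — the fine site with offset `r` of the block of
the coarse site `z` (companion of ✓`Node00.emb_coverAt`, which is the case `r = (L−1)/2`). [cite: Balaban1987RG1, (0.1)-(0.3) pp.251-252] -/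
theorem blockSite_coverAt {j : ℕ} (hj : j + 1 ≤ P.m + P.K) (z : Pt P.d) (r : Fin P.d → Fin P.L) :
    Site.blockSite (coverAt P (j + 1) z) r = coverAt P j (fun μ => (P.L : ℤ) * z μ + ((r μ : ℕ) : ℤ)) := by
  funext μ
  simp only [Site.blockSite, Node00.coverAt_apply]
  rw [← Int.cast_natCast, ZMod.intCast_eq_intCast_iff_dvd_sub]
  refine ⟨z μ / (P.sitesPerDir (j + 1) : ℕ), ?_⟩
  push_cast
  rw [ZMod.val_intCast, P.sitesPerDir_eq_mul_succ hj]
  push_cast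
  have h := Int.emod_add_mul_ediv (z μ) (P.sitesPerDir (j + 1) : ℕ)
  linear_combination (-(P.L : ℤ)) * h

/-- `⌊(w + N·u)∕N⌋ = ⌊w∕N⌋ + u` coordinatewise. [folklore] -/
theorem blockMap_add_natCast_smul (N : ℕ) [NeZero N] (w u : Pt P.d) :
    blockMap N (w + (N : ℤ) • u) = blockMap N w + u := by
  funext i
  simp only [blockMap, Pi.add_apply, Pi.smul_apply, smul_eq_mul]
  have hN : (N : ℤ) ≠ 0 := by exact_mod_cast NeZero.ne N
  rw [show w i + (N : ℤ) * u i = w i + u i * (N : ℤ) by ring, Int.add_mul_ediv_right _ _ hN]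

/-- Translating a label translates its block: `Σ_{w ∈ B_N(x + v)} F w = Σ_{w ∈ B_N(x)} F (w + N·v)`. [folklore] -/
theorem sum_blockSites_add {M : Type*} [AddCommMonoid M] (N : ℕ) [NeZero N] (x v : Pt P.d) (F : Pt P.d → M) :
    ∑ w ∈ blockSites N (x + v), F w = ∑ w ∈ blockSites N x, F (w + (N : ℤ) • v) := by
  have hshift := blockMap_add_natCast_smul (P := P) N
  refine Finset.sum_nbij' (fun w => w - (N : ℤ) • v) (fun w => w + (N : ℤ) • v) (fun w hw => ?_) (fun w hw => ?_)
    (fun w _ => sub_add_cancel w _) (fun w _ => add_sub_cancel_right w _) (fun w _ => by rw [sub_add_cancel])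
  · rw [mem_blockSites_iff] at hw ⊢
    have h2 := hshift (w - (N : ℤ) • v) v
    rw [sub_add_cancel, hw] at h2
    exact (add_right_cancel h2).symm
  · rw [mem_blockSites_iff] at hw ⊢
    rw [hshift, hw]

end Cover

/-! ## §3 Lattice telescoping: a step bound inside a box controls differences by the `ℓ¹` distance -/

section Telescoping

variable {d : ℕ} {E : Type*} [SeminormedAddCommGroup E]

/-- **`ℓ¹` TELESCOPING IN A BOX**: if every lattice step inside the box `[lo, hi]` changes `f` by at most `g`, then for two points of the box
`‖f x′ − f x‖ ≤ |x′ − x|₁·g` (a monotone staircase between two points of a box stays in the box). [folklore] -/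
theorem norm_sub_le_l1_mul_of_box (f : (Fin d → ℤ) → E) {lo hi : Fin d → ℤ} {g : ℝ}
    (hstep : ∀ (x : Fin d → ℤ) (ν : Fin d), InBox lo hi x → InBox lo hi (x + e ν) → ‖f (x + e ν) - f x‖ ≤ g) :
    ∀ (n : ℕ) (x x' : Fin d → ℤ), l1 (x' - x) = n → InBox lo hi x → InBox lo hi x' → ‖f x' - f x‖ ≤ (n : ℝ) * g := by
  intro n
  induction n with
  | zero =>
    intro x x' hn _ _
    have h0 : x' - x = 0 := by
      funext κ
      have := Finset.sum_eq_zero_iff.1 hn κ (Finset.mem_univ κ)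
      simpa using this
    rw [sub_eq_zero.1 h0, sub_self, norm_zero, Nat.cast_zero, zero_mul]
  | succ n ih =>
    intro x x' hn hx hx'
    -- a coordinate in which `x′ ≠ x`
    obtain ⟨κ, hκ⟩ : ∃ κ, (x' - x) κ ≠ 0 := by
      by_contra h
      push Not at h
      have : l1 (x' - x) = 0 := Finset.sum_eq_zero fun κ _ => by rw [h κ]; rfl
      omega
    -- step from `x′` one unit towards `x` in direction `κ`
    rcases lt_or_gt_of_ne hκ with hneg | hpos
    · -- `x′ κ < x κ`: the point `x′ + e κ` is in the box and closer to `x`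
      set x'' := x' + e κ with hx''
      have hbox : InBox lo hi x'' := fun i => by
        by_cases hi : i = κ
        · subst hi
          have h1 := (hx' i).1; have h2 := (hx i).2
          have hlt : x' i < x i := by have := hneg; simp only [Pi.sub_apply] at this; linarith
          simp only [hx'', Pi.add_apply, e_apply, if_true]
          constructor <;> linarith
        · simp only [hx'', Pi.add_apply, e_apply, hi, if_false, add_zero]; exact hx' i
      have hl1 : l1 (x'' - x) = n := by
        have hdecomp : x' - x = (x'' - x) + (-1 : ℤ) • e κ := by
          funext i; simp only [hx'', Pi.add_apply, Pi.sub_apply, Pi.smul_apply, e_apply, smul_eq_mul]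
          split_ifs <;> ring
        have hcoord : ∀ i, ((x'' - x) i).natAbs + (if i = κ then 1 else 0) = ((x' - x) i).natAbs := by
          intro i
          by_cases hi : i = κ
          · subst hi
            simp only [hx'', Pi.sub_apply, Pi.add_apply, e_apply, if_true]
            have : (x' i - x i) < 0 := by simpa [Pi.sub_apply] using hneg
            omega
          · simp only [hx'', Pi.sub_apply, Pi.add_apply, e_apply, hi, if_false, add_zero]
        have hsum : l1 (x'' - x) + 1 = l1 (x' - x) := by
          unfold l1
          rw [show (1 : ℕ) = ∑ i : Fin d, (if i = κ then 1 else 0) by simp, ← Finset.sum_add_distrib]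
          exact Finset.sum_congr rfl fun i _ => hcoord i
        omega
      have h1 := ih x x'' hl1 hx hbox
      have h2 : ‖f x'' - f x'‖ ≤ g := hstep x' κ hx' hbox
      calc ‖f x' - f x‖ = ‖(f x'' - f x) - (f x'' - f x')‖ := by congr 1; abel
        _ ≤ ‖f x'' - f x‖ + ‖f x'' - f x'‖ := norm_sub_le _ _
        _ ≤ (n : ℝ) * g + g := add_le_add h1 h2
        _ = ((n + 1 : ℕ) : ℝ) * g := by push_cast; ring
    · -- `x κ < x′ κ`: the point `x′ − e κ` is in the box and closer to `x`
      set x'' := x' - e κ with hx''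
      have hbox : InBox lo hi x'' := fun i => by
        by_cases hi : i = κ
        · subst hi
          have h1 := (hx i).1; have h2 := (hx' i).2
          have hlt : x i < x' i := by have := hpos; simp only [Pi.sub_apply] at this; linarith
          simp only [hx'', Pi.sub_apply, e_apply, if_true]
          constructor <;> linarith
        · simp only [hx'', Pi.sub_apply, e_apply, hi, if_false, sub_zero]; exact hx' i
      have hl1 : l1 (x'' - x) = n := by
        have hcoord : ∀ i, ((x'' - x) i).natAbs + (if i = κ then 1 else 0) = ((x' - x) i).natAbs := by
          intro i
          by_cases hi : i = κ
          · subst hi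
            simp only [hx'', Pi.sub_apply, e_apply, if_true]
            have : 0 < (x' i - x i) := by simpa [Pi.sub_apply] using hpos
            omega
          · simp only [hx'', Pi.sub_apply, e_apply, hi, if_false, sub_zero, add_zero]
        have hsum : l1 (x'' - x) + 1 = l1 (x' - x) := by
          unfold l1
          rw [show (1 : ℕ) = ∑ i : Fin d, (if i = κ then 1 else 0) by simp, ← Finset.sum_add_distrib]
          exact Finset.sum_congr rfl fun i _ => hcoord i
        omega
      have h1 := ih x x'' hl1 hx hbox
      have hx'eq : x' = x'' + e κ := by rw [hx'', sub_add_cancel]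
      have h2 : ‖f x' - f x''‖ ≤ g := by rw [hx'eq]; exact hstep x'' κ hbox (hx'eq ▸ hx')
      calc ‖f x' - f x‖ = ‖(f x' - f x'') + (f x'' - f x)‖ := by congr 1; abel
        _ ≤ ‖f x' - f x''‖ + ‖f x'' - f x‖ := norm_add_le _ _
        _ ≤ g + (n : ℝ) * g := add_le_add h2 h1
        _ = ((n + 1 : ℕ) : ℝ) * g := by push_cast; ring

end Telescoping

/-! ## §4 The oscillation transfer: a fine-lattice step bound controls the oscillation of the iterated site averages -/

section Oscillation

variable {P : Params} {V : Type*} [NormedAddCommGroup V] [NormedSpace ℝ V]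

omit [NormedSpace ℝ V] in
/-- `|N·v|₁ = N·|v|₁`. [folklore] -/
theorem l1_natCast_smul {d : ℕ} (N : ℕ) (v : Fin d → ℤ) : l1 ((N : ℤ) • v) = N * l1 v := by
  unfold l1
  rw [Finset.mul_sum]
  refine Finset.sum_congr rfl fun κ _ => ?_
  rw [Pi.smul_apply, smul_eq_mul, Int.natAbs_mul, Int.natAbs_natCast]

/-- ★★ **THE OSCILLATION TRANSFER** (the `hosc` supplier of ✓`P1FlatCoreFrameLinTowerSum` ∕ ✓`P1FlatCoreFrameLinLipschitz` from a GRADIENT row): if a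
fine field `l₀` read on the cover changes by at most `g` across every lattice step inside a box `[lo, hi] ⊂ ℤᵈ`, then for two level-`j` labels `x, x′`
whose `Lʲ`-blocks lie in the box the `j`-fold site averages differ by at most `|x′ − x|₁·Lʲ·g`:
`‖(Q′_j l₀)(π_j x′) − (Q′_j l₀)(π_j x)‖ ≤ |x′ − x|₁·Lʲ·g` — each of the `L^{jd}` fine sites of `Bʲ(x)` is `Lʲ|x′ − x|₁` steps from its
translate in `Bʲ(x′)`.  With `g = α₄L^{−k}` (the (1.120) gradient row at the flat background) and `|x′ − x|₁ ≤ d(L−1)` inside one `(j+1)`-block this is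
`≤ d(L−1)α₄·L^{j−k}`, geometric from the top as the tower induction wants. [cite: Balaban1985RegularSpaces, (1.120) p.96; Balaban1984PropagatorsI, (1.20) p.20] -/
theorem norm_siteAvgIter_coverAt_sub_le {j : ℕ} (hj : j ≤ P.m + P.K) (l₀ : Site P 0 → V) {lo hi : Pt P.d} {g : ℝ}
    (hstep : ∀ (w : Pt P.d) (ν : Fin P.d), InBox lo hi w → InBox lo hi (w + e ν) → ‖l₀ (cover P (w + e ν)) - l₀ (cover P w)‖ ≤ g)
    (x x' : Pt P.d) (hx : ∀ w ∈ blockSites (P.L ^ j) x, InBox lo hi w) (hx' : ∀ w ∈ blockSites (P.L ^ j) x', InBox lo hi w) :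
    ‖siteAvgIter j l₀ (coverAt P j x') - siteAvgIter j l₀ (coverAt P j x)‖ ≤ (l1 (x' - x) : ℝ) * (P.L : ℝ) ^ j * g := by
  haveI : NeZero (P.L ^ j) := ⟨pow_ne_zero _ P.L_pos.ne'⟩
  set N : ℕ := P.L ^ j with hN
  set v : Pt P.d := x' - x with hv
  have hx'eq : x' = x + v := by rw [hv]; abel
  rw [siteAvgIter_coverAt hj, siteAvgIter_coverAt hj, hx'eq, sum_blockSites_add N x v, ← smul_sub, ← Finset.sum_sub_distrib]
  -- each fine site of `Bʲ(x)` against its translate in `Bʲ(x′)`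
  have hterm : ∀ w ∈ blockSites N x, ‖l₀ (cover P (w + (N : ℤ) • v)) - l₀ (cover P w)‖ ≤ ((N * l1 v : ℕ) : ℝ) * g := by
    intro w hw
    have hw' : w + (N : ℤ) • v ∈ blockSites N x' := by
      rw [mem_blockSites_iff] at hw ⊢
      rw [blockMap_add_natCast_smul, hw, hx'eq]
    have h := norm_sub_le_l1_mul_of_box (fun w => l₀ (cover P w)) hstep (N * l1 v) w (w + (N : ℤ) • v)
      (by rw [add_sub_cancel_left, l1_natCast_smul]) (hx w hw) (hx' _ hw')
    exact h
  have hsum : ‖∑ w ∈ blockSites N x, (l₀ (cover P (w + (N : ℤ) • v)) - l₀ (cover P w))‖ ≤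
      (N : ℝ) ^ P.d * (((N * l1 v : ℕ) : ℝ) * g) := by
    refine (norm_sum_le _ _).trans ?_
    calc ∑ w ∈ blockSites N x, ‖l₀ (cover P (w + (N : ℤ) • v)) - l₀ (cover P w)‖
        ≤ ∑ _w ∈ blockSites N x, ((N * l1 v : ℕ) : ℝ) * g := Finset.sum_le_sum hterm
      _ = (N : ℝ) ^ P.d * (((N * l1 v : ℕ) : ℝ) * g) := by
          rw [Finset.sum_const, card_blockSites, nsmul_eq_mul]; push_cast; ring
  have hc : 0 ≤ ((((P.L : ℝ) ^ P.d) ^ j)⁻¹) := by positivity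
  have hNd : (((P.L : ℝ) ^ P.d) ^ j)⁻¹ * (N : ℝ) ^ P.d = 1 := by
    rw [hN]; push_cast
    have hL0 : (P.L : ℝ) ≠ 0 := by exact_mod_cast P.L_pos.ne'
    rw [← pow_mul, ← pow_mul, mul_comm P.d j, inv_mul_cancel₀ (pow_ne_zero _ hL0)]
  calc ‖(((P.L : ℝ) ^ P.d) ^ j)⁻¹ • ∑ w ∈ blockSites N x, (l₀ (cover P (w + (N : ℤ) • v)) - l₀ (cover P w))‖
      = (((P.L : ℝ) ^ P.d) ^ j)⁻¹ * ‖∑ w ∈ blockSites N x, (l₀ (cover P (w + (N : ℤ) • v)) - l₀ (cover P w))‖ := by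
        rw [norm_smul, Real.norm_of_nonneg hc]
    _ ≤ (((P.L : ℝ) ^ P.d) ^ j)⁻¹ * ((N : ℝ) ^ P.d * (((N * l1 v : ℕ) : ℝ) * g)) := mul_le_mul_of_nonneg_left hsum hc
    _ = (l1 (x' - x) : ℝ) * (P.L : ℝ) ^ j * g := by
        rw [← mul_assoc, hNd, one_mul, hN, hv]; push_cast; ring

end Oscillation

/-! ## §5 The (o)-target as an element of the `X`-space -/

section Target

variable {d : ℕ} {𝔸 : Type*} [NormedRing 𝔸]

/-- ★ **PACKAGING THE TOP TARGET.**  A datum `t` on the top index sites `Λ` bounded by `τ ≥ 0` there defines `th ∈ X` (bounded functions on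
`Fin (k+1) × ℤᵈ`, sup norm) with `th (k, y) = t y` for `y ∈ Λ`, `th (j, y) = 0` for `j < k` and for `y ∉ Λ`, and `‖th‖ ≤ τ`; if `t` is skew on `Λ`
(`t⋆ = −t`, as the logarithm of a unitary) then so is `th` everywhere (the socket's `hth`). [cite: Balaban1985RegularSpaces, p.95 («configurations X : 𝔅_k → 𝔤»), (1.119) p.96] -/
theorem exists_topTarget [StarAddMonoid 𝔸] (k : ℕ) (Λ : Set (Fin d → ℤ)) (t : (Fin d → ℤ) → 𝔸) {τ : ℝ} (hτ : 0 ≤ τ)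
    (ht : ∀ y ∈ Λ, ‖t y‖ ≤ τ) :
    ∃ th : XSpace d k 𝔸,
      (∀ y ∈ Λ, th (⟨k, Nat.lt_succ_self k⟩, y) = t y) ∧
      (∀ (j : ℕ) (hj : j < k) (y : Fin d → ℤ), th (⟨j, Nat.lt_succ_of_lt hj⟩, y) = 0) ∧
      (∀ y, y ∉ Λ → th (⟨k, Nat.lt_succ_self k⟩, y) = 0) ∧
      ‖th‖ ≤ τ ∧
      ((∀ y ∈ Λ, star (t y) = -t y) → ∀ p, star (th p) = -th p) := by
  classical
  let f : Fin (k + 1) × (Fin d → ℤ) → 𝔸 := fun p => if (p.1 : ℕ) = k ∧ p.2 ∈ Λ then t p.2 else 0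
  have hf : ∀ p, ‖f p‖ ≤ τ := fun p => by
    by_cases h : (p.1 : ℕ) = k ∧ p.2 ∈ Λ
    · simp only [f, h, and_self, if_true]; exact ht p.2 h.2
    · simp only [f, h, if_false, norm_zero]; exact hτ
  refine ⟨BoundedContinuousFunction.ofNormedAddCommGroupDiscrete f τ hf, fun y hy => ?_, fun j hj y => ?_, fun y hy => ?_, ?_, fun hsk p => ?_⟩
  · show f (⟨k, _⟩, y) = t y
    simp only [f, hy, and_true, if_true]
  · show f (⟨j, _⟩, y) = 0
    have : ¬ ((j : ℕ) = k ∧ y ∈ Λ) := fun h => absurd h.1 (Nat.ne_of_lt hj)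
    simp only [f, this, if_false]
  · show f (⟨k, _⟩, y) = 0
    simp only [f, hy, and_false, if_false]
  · exact (BoundedContinuousFunction.norm_le hτ).2 fun p => hf p
  · show star (f p) = -f p
    by_cases h : (p.1 : ℕ) = k ∧ p.2 ∈ Λ
    · simp only [f, h, and_self, if_true]; exact hsk p.2 h.2
    · simp only [f, h, if_false, star_zero, neg_zero]

end Target

/-! ## §6 (v1.1, APPEND-ONLY) The socket's tower box is the prelude's block -/

section TowerBox

/-- **THE TOWER BOX IS THE `ℤᵈ` BLOCK**: `[tlo L y k, thi L y k] = blockSites (Lᵏ) y` — the (1.120)-box of the socket's rows (`B8Ineq130.tlo∕thi`) in the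
prelude's block vocabulary (`QuantumLattice.blockSites`, J1b's `blockMap_pow_eq_flm`); the letter through which ✓`siteAvgIter_comp_rep_coverAt_eq_qprimeIter`'s
`hrep` (block membership) is fed from the socket's box-shaped hypotheses. [cite: Balaban1985RegularSpaces, (1.6) p.77, (1.120) p.96] -/
theorem inBox_tlo_thi_iff_mem_blockSites {d L : ℕ} (hL : 1 ≤ L) (k : ℕ) (y z : Fin d → ℤ) :
    InBox (B8Ineq130.tlo L y k) (B8Ineq130.thi L y k) z ↔ z ∈ blockSites (L ^ k) y := by
  haveI : NeZero (L ^ k) := ⟨pow_ne_zero _ (by omega)⟩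
  have hpos : (0 : ℤ) < (L : ℤ) ^ k := pow_pos (by exact_mod_cast hL) k
  rw [mem_blockSites_iff, P1FlatCoreCubeInclusion.blockMap_pow_eq_flm]
  constructor
  · intro h
    funext i
    obtain ⟨h1, h2⟩ := h i
    rw [B8Ineq130.tlo_apply] at h1
    rw [B8Ineq130.thi_apply] at h2
    simp only [B8Eq131Cubes.flm]
    have hlo : y i ≤ z i / (L : ℤ) ^ k := Int.le_ediv_of_mul_le hpos (by linarith)
    have hhi : z i / (L : ℤ) ^ k < y i + 1 := Int.ediv_lt_of_lt_mul hpos (by linarith)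
    omega
  · rintro rfl i
    rw [B8Ineq130.tlo_apply, B8Ineq130.thi_apply]
    simp only [B8Eq131Cubes.flm]
    have h1 : z i % (L : ℤ) ^ k + z i / (L : ℤ) ^ k * (L : ℤ) ^ k = z i := Int.emod_add_ediv_mul (z i) _
    have h2 := Int.emod_nonneg (z i) hpos.ne'
    have h3 := Int.emod_lt_of_pos (z i) hpos
    constructor <;> nlinarith

end TowerBox

end Summit.QuantumFields.YangMills.Theorems.P1FlatCoreTopDictionary

end
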